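import Summits.AtomisticToContinuum.Crystallization.Theorems.FrustratedLawDichotomyCellTEQ15Data

/-!
# FrustratedLawDichotomy · crux `AperiodicFrustratedLawGap` (stmt-AtomisticToContinuum-27623) — TEQ15 witness cell: class 1 sums A
# (decomp-a2c, prover hand 2, generation 17; each theorem ONE `decide +kernel`, split for the farm's per-declaration budget). [folklore]
-/

namespace Summit.AtomisticToContinuum.Crystallization.Theorems.FrustratedLawDichotomyCellTEQ15

open scoped BigOperators
open Summit.AtomisticToContinuum.Crystallization.Theorems.FrustratedLawDichotomyCellChecker
open Summit.AtomisticToContinuum.Crystallization.Theorems.FrustratedLawDichotomyCellKitX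

set_option maxHeartbeats 0 in
/-- Kernel value of the `S` sum of class `1`. [folklore] -/
theorem teq15_sum1_S : sumX cellTEQ15 (termS cellTEQ15 cellTEQ15P ⟨1, by decide⟩) = ((-1053096618753 : ℚ) / 1099511627776) := by decide +kernel

set_option maxHeartbeats 0 in
/-- Kernel value of the `F0` sum of class `1`. [folklore] -/
theorem teq15_sum1_F0 : sumX cellTEQ15 (termF cellTEQ15 cellTEQ15P 0 ⟨1, by decide⟩) = ((-29493293219 : ℚ) / 274877906944) := by decide +kernel

set_option maxHeartbeats 0 in
/-- Kernel value of the `F1` sum of class `1`. [folklore] -/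
theorem teq15_sum1_F1 : sumX cellTEQ15 (termF cellTEQ15 cellTEQ15P 1 ⟨1, by decide⟩) = ((6501617001 : ℚ) / 549755813888) := by decide +kernel

set_option maxHeartbeats 0 in
/-- Kernel value of the `F2` sum of class `1`. [folklore] -/
theorem teq15_sum1_F2 : sumX cellTEQ15 (termF cellTEQ15 cellTEQ15P 2 ⟨1, by decide⟩) = ((6563377645 : ℚ) / 1099511627776) := by decide +kernel

end Summit.AtomisticToContinuum.Crystallization.Theorems.FrustratedLawDichotomyCellTEQ15
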